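import Summits.KontsevichZagierPeriods.KontsevichZagierPeriods.Theses.LiftingCriteria
import Summits.KontsevichZagierPeriods.KontsevichZagierPeriods.Theorems.SymplecticScissorsPlanarSAZylevStubTeCalc
import Literature.NumberTheory.Transcendental.SemialgebraicLineDeriv
import Literature.NumberTheory.Transcendental.KZSliceFubini

/-!
# `DilationLiftAtOne`, line `registered`: local purity at `ϖ = 1` (stub S2)

Stub `stub_localPurityAtOne` of the crux `LiftingCriteria.DilationLiftAtOne`
(stmt-KontsevichZagierPeriods-3571). For ONE Nash cube function `h` of dimension `N`
(`ℚ`-semialgebraic and real-analytic on an open `W ⊇ [0,1]^N`) with `∫_{[0,1]^N} h = 0`, the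
dilation function `v_h(ϖ) = ∫_{[0,1]^N} h(ϖ z) dz` factors NEAR `ϖ = 1` through a twisted-diagonal
Nash kernel: `v_h(ϖ) = (ϖ − 1) ∫_{[0,1]^{N+1}} K₁(ϖ, ϖ y) dy` for `ϖ ∈ (1 − ε, 1]`, with `K₁`
`ℚ`-semialgebraic and analytic on an open `V₁ ⊇ (1 − ε, 1] × [0,1]^{N+1}`.

Witness (no differentiation under the integral sign). For `z ∈ [0,1]^N` the segment
`t ↦ (1 − t + ϖ t) z` stays in the cube, so the fundamental theorem of calculus along it gives
`h(ϖ z) − h(z) = (ϖ − 1) ∫₀¹ Σₖ zₖ ∂ₖh((1 − t + ϖ t) z) dt` (`localPurity_ftc`); integrating over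
the cube, using `∫ h = 0`, and merging `∫_{[0,1]^N} ∫₀¹` into `∫_{[0,1]^{N+1}}` (Fubini along
`(t, z) ↦ vecCons t z`, `localPurity_integral_cube_succ`) gives the factorisation with
`K₁(p) = Σₖ (p_{k+2}/p₀) ∂ₖh(arg p)`, `arg(p) = ((1 − p₁/p₀ + p₁) p_{k+2}/p₀)ₖ`, on
`V₁ = {p₀ > 1/2} ∩ arg⁻¹(W)` (`localPurity_kernel_cons`: at `p = (ϖ, ϖt, ϖz)`,
`arg p = (1 − t + ϖ t) z`). `K₁` is `ℚ`-semialgebraic since partial derivatives of semialgebraic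
functions are (Basu–Pollack–Roy 2006, Prop. 3.22: `IsSemialgebraicFunOn.fderiv_apply_single`) and
so are composites with rational maps (Bochnak–Coste–Roy 1998, Prop. 2.2.6); it is analytic as a
sum of products of rational functions with `∂ₖh ∘ arg`. Finally `ε = min(1/2, δ/(1+δ))` for a
margin `δ > 0` with `[0, 1+δ]^N ⊆ W` (compactness of the cube): for `ϖ ∈ (1 − ε, 1]` and
`x ∈ [0,1]^{N+1}` the coordinates of `arg(ϖ, x)` lie in `[0, 1/ϖ] ⊆ [0, 1 + δ]`.

References: M. Kontsevich, D. Zagier, *Periods* (2001), §1.2; S. Basu, R. Pollack, M.-F. Roy,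
*Algorithms in Real Algebraic Geometry* (2006), Prop. 3.22; J. Bochnak, M. Coste, M.-F. Roy,
*Real Algebraic Geometry* (1998), Prop. 2.2.6–2.2.7. Everything is proved; no `def`, no named fact.
-/

noncomputable section

open scoped BigOperators
open MeasureTheory Set
open Literature.NumberTheory.Transcendental Literature.ModelTheory.ExponentialFields

namespace Summit.KontsevichZagierPeriods.LiftingCriteria.DilationLiftAtOne

/-- The closed unit cube `[0,1]ⁿ ⊆ ℝⁿ`, as the `Set.pi` of the stub's statement (local notation). -/
local notation:max "𝐈^" n:max => (Set.pi Set.univ (fun _ : Fin n => Set.Icc (0:ℝ) 1))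

/-! ### Generalities -/

/-- A continuous linear functional on `ℝ^N` expanded in the coordinate basis:
`L v = Σₖ vₖ · L eₖ`. [folklore] -/
theorem localPurity_clm_apply_eq_sum {N : ℕ} (L : (Fin N → ℝ) →L[ℝ] ℝ) (v : Fin N → ℝ) :
    L v = ∑ k, v k * L (Pi.single k 1) := by
  have hv : v = ∑ k, Pi.single k (v k) := (Finset.univ_sum_single v).symm
  calc L v = L (∑ k, Pi.single k (v k)) := by rw [← hv]
    _ = ∑ k, L (Pi.single k (v k)) := map_sum L _ _
    _ = ∑ k, v k * L (Pi.single k 1) := Finset.sum_congr rfl fun k _ => by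
        rw [← smul_eq_mul, ← ContinuousLinearMap.map_smul, ← Pi.single_smul, smul_eq_mul, mul_one]

/-- The directional derivative `x ↦ Dh(x) · v` of a function analytic near a set is analytic near
it (as in `FurushoPentagon.SectorToKernel.stokesCal_analyticOnNhd_fderiv_apply`). [folklore] -/
theorem localPurity_analyticOnNhd_fderiv_apply {N : ℕ} {h : (Fin N → ℝ) → ℝ}
    {W : Set (Fin N → ℝ)} (hWa : AnalyticOnNhd ℝ h W) (v : Fin N → ℝ) :
    AnalyticOnNhd ℝ (fun x => fderiv ℝ h x v) W := by
  rw [show (fun x => fderiv ℝ h x v) = (ContinuousLinearMap.apply ℝ ℝ v) ∘ fderiv ℝ h from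
    funext fun w => by simp]
  exact (ContinuousLinearMap.apply ℝ ℝ v).comp_analyticOnNhd hWa.fderiv

/-- **Margin of an open neighbourhood of the closed unit cube.** If `W ⊇ [0,1]^N` is open, some
box `[0, 1 + δ]^N`, `δ > 0`, is still contained in `W` (the cube is compact, so a closed
`δ`-thickening of it lies in `W`; a point of the box is within sup-distance `δ` of its truncation
`(min(zₖ, 1))ₖ` in the cube). [folklore] -/
theorem localPurity_exists_margin {N : ℕ} {W : Set (Fin N → ℝ)} (hWo : IsOpen W)
    (hWc : 𝐈^N ⊆ W) : ∃ δ : ℝ, 0 < δ ∧ ∀ z : Fin N → ℝ, (∀ k, 0 ≤ z k ∧ z k ≤ 1 + δ) → z ∈ W := by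
  obtain ⟨δ, hδ, hsub⟩ :=
    (isCompact_univ_pi fun _ : Fin N => isCompact_Icc).exists_cthickening_subset_open hWo hWc
  refine ⟨δ, hδ, fun z hz => hsub ?_⟩
  refine Metric.mem_cthickening_of_dist_le z (fun k => min (z k) 1) δ _ ?_ ?_
  · exact Set.mem_univ_pi.2 fun k => ⟨le_min (hz k).1 zero_le_one, min_le_right _ _⟩
  · refine (dist_pi_le_iff hδ.le).2 fun k => ?_
    rw [Real.dist_eq]
    rcases le_total (z k) 1 with h | h
    · rw [min_eq_left h, sub_self, abs_zero]
      exact hδ.le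
    · rw [min_eq_right h, abs_of_nonneg (sub_nonneg.2 h)]
      linarith [(hz k).2]

/-- **Fubini over the first cube coordinate.** For `F` integrable on `[0,1]^{n+1}`,
`∫_{[0,1]^{n+1}} F = ∫_{z ∈ [0,1]^n} ∫_{t ∈ [0,1]} F(vecCons t z)`: the cube measure is a product
measure (`Measure.restrict_pi_pi`) and `(t, z) ↦ vecCons t z` is the (measure-preserving) inverse
of `MeasurableEquiv.piFinSuccAbove _ 0` (`KZ.vecCons_eq_piFinSuccAbove_symm`). [folklore] -/
theorem localPurity_integral_cube_succ (n : ℕ) (F : (Fin (n + 1) → ℝ) → ℝ)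
    (hF : IntegrableOn F (𝐈^(n + 1))) :
    (∫ y in 𝐈^(n + 1), F y) = ∫ z in 𝐈^n, ∫ t in Set.Icc (0:ℝ) 1, F (Matrix.vecCons t z) := by
  have hcube : ∀ m : ℕ, (volume : Measure (Fin m → ℝ)).restrict (𝐈^m) =
      Measure.pi fun _ : Fin m => (volume : Measure ℝ).restrict (Set.Icc (0:ℝ) 1) := fun m => by
    rw [volume_pi]
    exact Measure.restrict_pi_pi _ _
  have hmp : MeasurePreserving (fun p : ℝ × (Fin n → ℝ) => Matrix.vecCons p.1 p.2)
      (((volume : Measure ℝ).restrict (Set.Icc (0:ℝ) 1)).prod ((volume.restrict (𝐈^n))))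
      (volume.restrict (𝐈^(n + 1))) := by
    rw [hcube, hcube, KZ.vecCons_eq_piFinSuccAbove_symm]
    exact (measurePreserving_piFinSuccAbove
      (fun _ : Fin (n + 1) => (volume : Measure ℝ).restrict (Set.Icc (0:ℝ) 1)) 0).symm _
  rw [← hmp.integral_comp KZ.measurableEmbedding_vecCons F]
  exact integral_prod_symm _ ((hmp.integrable_comp_emb KZ.measurableEmbedding_vecCons).2 hF)

/-! ### The segment `t ↦ (1 - t + ϖ t) z` and the fundamental theorem of calculus -/

/-- For `ϖ, t ∈ [0,1]` and `z` in the closed unit cube, the point `(1 - t + ϖ t) z` of the segment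
from `z` to `ϖ z` lies in the cube (`1 - t + ϖ t ∈ [ϖ, 1]`). [folklore] -/
theorem localPurity_path_mem {N : ℕ} {ϖ t : ℝ} {z : Fin N → ℝ} (hϖ : ϖ ∈ Set.Icc (0:ℝ) 1)
    (ht : t ∈ Set.Icc (0:ℝ) 1) (hz : z ∈ 𝐈^N) : (1 - t + ϖ * t) • z ∈ 𝐈^N := by
  rw [Set.mem_univ_pi] at hz ⊢
  intro k
  have hc0 : 0 ≤ 1 - t + ϖ * t := by nlinarith [hϖ.1, hϖ.2, ht.1, ht.2]
  have hc1 : 1 - t + ϖ * t ≤ 1 := by nlinarith [hϖ.1, hϖ.2, ht.1, ht.2]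
  simp only [Pi.smul_apply, smul_eq_mul, Set.mem_Icc]
  exact ⟨mul_nonneg hc0 (hz k).1, mul_le_one₀ hc1 (hz k).1 (hz k).2⟩

/-- Dilations by `ϖ ∈ [0,1]` preserve the closed unit cube (`t = 1` above). [folklore] -/
theorem localPurity_smul_mem {N : ℕ} {ϖ : ℝ} {z : Fin N → ℝ} (hϖ : ϖ ∈ Set.Icc (0:ℝ) 1)
    (hz : z ∈ 𝐈^N) : ϖ • z ∈ 𝐈^N := by
  simpa using localPurity_path_mem hϖ ⟨zero_le_one, le_rfl⟩ hz

/-- **Chain rule along the segment.** If `h` is differentiable at `(1 - t + ϖ t) z`, then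
`s ↦ h((1 - s + ϖ s) z)` has derivative `(ϖ - 1) Σₖ zₖ ∂ₖh((1 - t + ϖ t) z)` at `s = t`
(`Dh(x)·((ϖ - 1) z) = (ϖ - 1) Σₖ zₖ Dh(x)·eₖ`). [folklore] -/
theorem localPurity_hasDerivAt_path {N : ℕ} {h : (Fin N → ℝ) → ℝ} (ϖ : ℝ) (z : Fin N → ℝ)
    (t : ℝ) (hd : DifferentiableAt ℝ h ((1 - t + ϖ * t) • z)) :
    HasDerivAt (fun s : ℝ => h ((1 - s + ϖ * s) • z))
      ((ϖ - 1) * ∑ k, z k * fderiv ℝ h ((1 - t + ϖ * t) • z) (Pi.single k 1)) t := by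
  have hγ : HasDerivAt (fun s : ℝ => (1 - s + ϖ * s) • z) ((ϖ - 1) • z) t :=
    ((((hasDerivAt_id' t).const_sub 1).add ((hasDerivAt_id' t).const_mul ϖ)).congr_deriv
      (by ring)).smul_const z
  exact (hd.hasFDerivAt.comp_hasDerivAt t hγ).congr_deriv
    (by rw [ContinuousLinearMap.map_smul, smul_eq_mul, localPurity_clm_apply_eq_sum])

/-- **FTC along the segment from `z` to `ϖ z`.** For `h` analytic on an open `W ⊇ [0,1]^N`,
`ϖ ∈ [0,1]` and `z ∈ [0,1]^N`:
`h(ϖ z) - h(z) = (ϖ - 1) ∫₀¹ Σₖ zₖ ∂ₖh((1 - t + ϖ t) z) dt`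
(`intervalIntegral.integral_eq_sub_of_hasDerivAt`; the derivative is continuous in `t` because
`∂ₖh` is analytic on `W` and the segment stays in the cube). [folklore] -/
theorem localPurity_ftc {N : ℕ} {h : (Fin N → ℝ) → ℝ} {W : Set (Fin N → ℝ)} (hWc : 𝐈^N ⊆ W)
    (hWa : AnalyticOnNhd ℝ h W) {ϖ : ℝ} (hϖ : ϖ ∈ Set.Icc (0:ℝ) 1) {z : Fin N → ℝ}
    (hz : z ∈ 𝐈^N) :
    h (ϖ • z) - h z =
      (ϖ - 1) * ∫ t in (0:ℝ)..1, ∑ k, z k * fderiv ℝ h ((1 - t + ϖ * t) • z) (Pi.single k 1) := by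
  have hmem : ∀ t ∈ Set.Icc (0:ℝ) 1, (1 - t + ϖ * t) • z ∈ W := fun t ht =>
    hWc (localPurity_path_mem hϖ ht hz)
  have hderiv : ∀ t ∈ Set.uIcc (0:ℝ) 1, HasDerivAt (fun s : ℝ => h ((1 - s + ϖ * s) • z))
      ((ϖ - 1) * ∑ k, z k * fderiv ℝ h ((1 - t + ϖ * t) • z) (Pi.single k 1)) t := by
    intro t ht
    rw [Set.uIcc_of_le zero_le_one] at ht
    exact localPurity_hasDerivAt_path ϖ z t (hWa _ (hmem t ht)).differentiableAt
  have hcont : ContinuousOn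
      (fun t => (ϖ - 1) * ∑ k, z k * fderiv ℝ h ((1 - t + ϖ * t) • z) (Pi.single k 1))
      (Set.uIcc (0:ℝ) 1) := by
    rw [Set.uIcc_of_le zero_le_one]
    refine continuousOn_const.mul (continuousOn_finsetSum _ fun k _ => continuousOn_const.mul ?_)
    intro t ht
    have hγ : Continuous fun s : ℝ => (1 - s + ϖ * s) • z := by fun_prop
    exact (ContinuousAt.comp' (f := fun s : ℝ => (1 - s + ϖ * s) • z) (x := t)
      (localPurity_analyticOnNhd_fderiv_apply hWa (Pi.single k 1) _ (hmem t ht)).continuousAt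
      hγ.continuousAt).continuousWithinAt
  have hftc := intervalIntegral.integral_eq_sub_of_hasDerivAt hderiv hcont.intervalIntegrable
  rw [intervalIntegral.integral_const_mul] at hftc
  rw [hftc]
  simp

/-! ### The kernel `K₁` and its domain `V₁` -/

/-- **The kernel on the twisted diagonal.** With `arg(p) = ((1 - p₁/p₀ + p₁) p_{k+2}/p₀)ₖ` and
`K₁(p) = Σₖ (p_{k+2}/p₀) Dₖ(arg p)`, at the point `p = vecCons ϖ (ϖ • vecCons t z) = (ϖ, ϖt, ϖz)`
(`ϖ ≠ 0`) one has `arg p = (1 - t + ϖ t) z` and `K₁ p = Σₖ zₖ Dₖ((1 - t + ϖ t) z)`. [folklore] -/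
theorem localPurity_kernel_cons {N : ℕ} (D : Fin N → (Fin N → ℝ) → ℝ)
    (arg : (Fin (N + 1 + 1) → ℝ) → Fin N → ℝ)
    (harg : ∀ p, arg p = fun j => (1 - p 1 / p 0 + p 1) * p j.succ.succ / p 0)
    (K₁ : (Fin (N + 1 + 1) → ℝ) → ℝ) (hK₁ : ∀ p, K₁ p = ∑ k, p k.succ.succ / p 0 * D k (arg p))
    {ϖ : ℝ} (hϖ : ϖ ≠ 0) (t : ℝ) (z : Fin N → ℝ) :
    K₁ (Matrix.vecCons ϖ (ϖ • Matrix.vecCons t z)) = ∑ k, z k * D k ((1 - t + ϖ * t) • z) := by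
  rw [hK₁, harg]
  refine Finset.sum_congr rfl fun k _ => ?_
  simp only [Matrix.smul_cons, smul_eq_mul, Matrix.cons_val_zero, Matrix.cons_val_one,
    Matrix.cons_val_succ, Pi.smul_apply, mul_div_cancel_left₀ _ hϖ]
  refine congrArg (fun w => z k * D k w) (funext fun j => ?_)
  rw [Pi.smul_apply, smul_eq_mul]
  field_simp

/-- The domain `V₁ = {p₀ > 1/2} ∩ arg⁻¹(W)` is open: `arg` is continuous on the open half-space
`{p₀ > 1/2}` (a rational map with non-vanishing denominator `p₀`) and `W` is open. [folklore] -/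
theorem localPurity_isOpen_V {N : ℕ} {W : Set (Fin N → ℝ)} (hWo : IsOpen W)
    (arg : (Fin (N + 1 + 1) → ℝ) → Fin N → ℝ)
    (harg : ∀ p, arg p = fun j => (1 - p 1 / p 0 + p 1) * p j.succ.succ / p 0) :
    IsOpen ({p : Fin (N + 1 + 1) → ℝ | (1 / 2 : ℝ) < p 0} ∩ arg ⁻¹' W) := by
  refine ContinuousOn.isOpen_inter_preimage (fun p hp => ?_)
    (isOpen_lt continuous_const (continuous_apply 0)) hWo
  have h0 : p 0 ≠ 0 := (one_half_pos.trans hp).ne'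
  have hc : ∀ i : Fin (N + 1 + 1), ContinuousAt (fun q : Fin (N + 1 + 1) → ℝ => q i) p :=
    fun i => (continuous_apply i).continuousAt
  refine ContinuousAt.continuousWithinAt ?_
  rw [funext harg]
  exact continuousAt_pi.2 fun j =>
    (((continuousAt_const.sub ((hc 1).div (hc 0) h0)).add (hc 1)).mul (hc _)).div (hc 0) h0

/-- The map `arg` is `ℚ`-semialgebraic on the half-space `{p₀ > 1/2}` (its coordinates are the
rational functions `(p₀ - p₁ + p₁p₀) p_{k+2} / p₀²`, `isSemialgebraicFunOn_aeval_div_aeval`), and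
the domain `V₁ = {p₀ > 1/2} ∩ arg⁻¹(W)` is `ℚ`-semialgebraic for `ℚ`-semialgebraic `W`
(preimage under a semialgebraic map, `PlanarSAZylev.teCalc_isSemialgebraic_preimage`;
Bochnak–Coste–Roy 1998, Prop. 2.2.6–2.2.7). [folklore] -/
theorem localPurity_isSemialgebraic_V {N : ℕ} {W : Set (Fin N → ℝ)} (hW : IsSemialgebraic ℚ W)
    (arg : (Fin (N + 1 + 1) → ℝ) → Fin N → ℝ)
    (harg : ∀ p, arg p = fun j => (1 - p 1 / p 0 + p 1) * p j.succ.succ / p 0) :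
    IsSemialgebraicMapOn ℚ {p : Fin (N + 1 + 1) → ℝ | (1 / 2 : ℝ) < p 0} arg ∧
    IsSemialgebraic ℚ ({p : Fin (N + 1 + 1) → ℝ | (1 / 2 : ℝ) < p 0} ∩ arg ⁻¹' W) := by
  have hS : IsSemialgebraic ℚ {p : Fin (N + 1 + 1) → ℝ | (1 / 2 : ℝ) < p 0} := by
    rw [show {p : Fin (N + 1 + 1) → ℝ | (1 / 2 : ℝ) < p 0} =
        {x | MvPolynomial.aeval x (MvPolynomial.C (1 / 2 : ℚ) : MvPolynomial (Fin (N + 1 + 1)) ℚ) <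
          MvPolynomial.aeval x (MvPolynomial.X 0 : MvPolynomial (Fin (N + 1 + 1)) ℚ)} from
      Set.ext fun p => by simp]
    exact isSemialgebraic_setOf_eval_lt _ _
  have h0 : ∀ p ∈ {p : Fin (N + 1 + 1) → ℝ | (1 / 2 : ℝ) < p 0}, p 0 ≠ 0 := fun p hp =>
    (one_half_pos.trans hp).ne'
  have harg' : IsSemialgebraicMapOn ℚ {p : Fin (N + 1 + 1) → ℝ | (1 / 2 : ℝ) < p 0} arg := by
    refine IsSemialgebraicMapOn.of_forall hS fun j => ?_
    refine (isSemialgebraicFunOn_aeval_div_aeval hS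
      ((MvPolynomial.X 0 - MvPolynomial.X 1 + MvPolynomial.X 1 * MvPolynomial.X 0) *
        MvPolynomial.X j.succ.succ) (MvPolynomial.X 0 ^ 2) fun p hp => ?_).congr fun p hp => ?_
    · simpa using pow_ne_zero 2 (h0 p hp)
    · have hp0 := h0 p hp
      rw [harg]
      simp only [map_mul, map_sub, map_add, map_pow, MvPolynomial.aeval_X]
      field_simp
  exact ⟨harg', SymplecticScissors.PlanarSAZylev.teCalc_isSemialgebraic_preimage (T := W) harg' hW⟩

/-- **`V₁` contains `(1 - ε, 1] × [0,1]^{N+1}`** for `ε = min(1/2, δ/(1+δ))`, where `δ > 0` is a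
margin with `[0, 1+δ]^N ⊆ W`: for `ϖ ∈ (1 - ε, 1]` and `x ∈ [0,1]^{N+1}` one has `ϖ > 1/2`,
`ϖ(1 + δ) > 1`, and the coordinates `(1 - x₀/ϖ + x₀) x_{k+1}/ϖ = (ϖ - x₀ + x₀ϖ) x_{k+1}/ϖ²` of
`arg(vecCons ϖ x)` lie in `[0, 1/ϖ] ⊆ [0, 1 + δ]`. [folklore] -/
theorem localPurity_cons_mem_V {N : ℕ} {W : Set (Fin N → ℝ)} {δ : ℝ} (hδ : 0 < δ)
    (hδW : ∀ z : Fin N → ℝ, (∀ k, 0 ≤ z k ∧ z k ≤ 1 + δ) → z ∈ W)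
    (arg : (Fin (N + 1 + 1) → ℝ) → Fin N → ℝ)
    (harg : ∀ p, arg p = fun j => (1 - p 1 / p 0 + p 1) * p j.succ.succ / p 0)
    {ϖ : ℝ} (hϖ : ϖ ∈ Set.Ioc (1 - min (1 / 2) (δ / (1 + δ))) 1)
    {x : Fin (N + 1) → ℝ} (hx : x ∈ 𝐈^(N + 1)) :
    Matrix.vecCons ϖ x ∈ {p : Fin (N + 1 + 1) → ℝ | (1 / 2 : ℝ) < p 0} ∩ arg ⁻¹' W := by
  rw [Set.mem_univ_pi] at hx
  have hϖhalf : (1 / 2 : ℝ) < ϖ := by linarith [hϖ.1, min_le_left (1 / 2 : ℝ) (δ / (1 + δ))]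
  have hϖpos : 0 < ϖ := one_half_pos.trans hϖhalf
  have hϖδ : 1 < ϖ * (1 + δ) := by
    have h1 : 1 - δ / (1 + δ) < ϖ := by linarith [hϖ.1, min_le_right (1 / 2 : ℝ) (δ / (1 + δ))]
    rw [show 1 - δ / (1 + δ) = 1 / (1 + δ) by field_simp; ring,
      div_lt_iff₀ (by linarith : (0:ℝ) < 1 + δ)] at h1
    exact h1
  refine ⟨show (1 / 2 : ℝ) < Matrix.vecCons ϖ x 0 by simpa using hϖhalf, ?_⟩
  show arg (Matrix.vecCons ϖ x) ∈ W
  refine hδW _ fun k => ?_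
  obtain ⟨hx0, hxk⟩ : x 0 ∈ Set.Icc (0:ℝ) 1 ∧ x k.succ ∈ Set.Icc (0:ℝ) 1 := ⟨hx 0, hx k.succ⟩
  rw [Set.mem_Icc] at hx0 hxk
  rw [harg]
  simp only [Matrix.cons_val_zero, Matrix.cons_val_one, Matrix.cons_val_succ]
  rw [show (1 - x 0 / ϖ + x 0) * x k.succ / ϖ = (ϖ - x 0 + x 0 * ϖ) * x k.succ / ϖ ^ 2 by
    field_simp]
  have hA : 0 ≤ ϖ - x 0 + x 0 * ϖ := by nlinarith
  have hB : ϖ - x 0 + x 0 * ϖ ≤ ϖ := by nlinarith [hϖ.2]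
  refine ⟨div_nonneg (mul_nonneg hA hxk.1) (sq_nonneg ϖ), ?_⟩
  rw [div_le_iff₀ (by positivity)]
  nlinarith [mul_le_mul hB hxk.2 hxk.1 hϖpos.le]

/-- **`K₁` is `ℚ`-semialgebraic on `V₁`** when the `Dₖ` are `ℚ`-semialgebraic on `W`: each summand
is the rational function `p_{k+2}/p₀` times the composite `Dₖ ∘ arg` of a semialgebraic function
with a semialgebraic map sending `V₁` into `W` (Bochnak–Coste–Roy 1998, Prop. 2.2.6,
`IsSemialgebraicFunOn.comp_isSemialgebraicMapOn_holds`), and finite sums and products of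
semialgebraic functions are semialgebraic. [folklore] -/
theorem localPurity_kernel_isSemialgebraicFunOn {N : ℕ} {W : Set (Fin N → ℝ)}
    (D : Fin N → (Fin N → ℝ) → ℝ) (hD : ∀ k, IsSemialgebraicFunOn ℚ W (D k))
    (arg : (Fin (N + 1 + 1) → ℝ) → Fin N → ℝ)
    (hargS : IsSemialgebraicMapOn ℚ {p : Fin (N + 1 + 1) → ℝ | (1 / 2 : ℝ) < p 0} arg)
    (hV : IsSemialgebraic ℚ ({p : Fin (N + 1 + 1) → ℝ | (1 / 2 : ℝ) < p 0} ∩ arg ⁻¹' W))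
    (K₁ : (Fin (N + 1 + 1) → ℝ) → ℝ) (hK₁ : ∀ p, K₁ p = ∑ k, p k.succ.succ / p 0 * D k (arg p)) :
    IsSemialgebraicFunOn ℚ ({p : Fin (N + 1 + 1) → ℝ | (1 / 2 : ℝ) < p 0} ∩ arg ⁻¹' W) K₁ := by
  have h0 : ∀ p ∈ {p : Fin (N + 1 + 1) → ℝ | (1 / 2 : ℝ) < p 0} ∩ arg ⁻¹' W, p 0 ≠ 0 :=
    fun p hp => (one_half_pos.trans hp.1).ne'
  have hcoef : ∀ k : Fin N, IsSemialgebraicFunOn ℚ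
      ({p : Fin (N + 1 + 1) → ℝ | (1 / 2 : ℝ) < p 0} ∩ arg ⁻¹' W) fun p => p k.succ.succ / p 0 :=
    fun k => (isSemialgebraicFunOn_aeval_div_aeval hV (MvPolynomial.X k.succ.succ)
      (MvPolynomial.X 0) fun p hp => by simpa using h0 p hp).congr fun p _ => by simp
  have hDarg : ∀ k : Fin N, IsSemialgebraicFunOn ℚ
      ({p : Fin (N + 1 + 1) → ℝ | (1 / 2 : ℝ) < p 0} ∩ arg ⁻¹' W) fun p => D k (arg p) :=
    fun k => IsSemialgebraicFunOn.comp_isSemialgebraicMapOn_holds (hD k)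
      (hargS.mono inter_subset_left hV) fun p hp => hp.2
  rw [funext hK₁]
  exact IsSemialgebraicFunOn.fun_finsetSum _ hV fun k _ => (hcoef k).fun_mul (hDarg k)

/-- **`K₁` is real-analytic on `V₁`** when the `Dₖ` are analytic on `W`: coordinates are analytic,
`arg` is analytic at every point with `p₀ ≠ 0`, `Dₖ ∘ arg` is analytic at points of `arg⁻¹(W)`,
and sums/products/quotients (non-vanishing denominator `p₀ > 1/2`) of analytic functions are
analytic. [folklore] -/
theorem localPurity_kernel_analyticOnNhd {N : ℕ} {W : Set (Fin N → ℝ)}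
    (D : Fin N → (Fin N → ℝ) → ℝ) (hD : ∀ k, AnalyticOnNhd ℝ (D k) W)
    (arg : (Fin (N + 1 + 1) → ℝ) → Fin N → ℝ)
    (harg : ∀ p, arg p = fun j => (1 - p 1 / p 0 + p 1) * p j.succ.succ / p 0)
    (K₁ : (Fin (N + 1 + 1) → ℝ) → ℝ) (hK₁ : ∀ p, K₁ p = ∑ k, p k.succ.succ / p 0 * D k (arg p)) :
    AnalyticOnNhd ℝ K₁ ({p : Fin (N + 1 + 1) → ℝ | (1 / 2 : ℝ) < p 0} ∩ arg ⁻¹' W) := by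
  intro p hp
  have h0 : p 0 ≠ 0 := (one_half_pos.trans hp.1).ne'
  have hc : ∀ i : Fin (N + 1 + 1), AnalyticAt ℝ (fun q : Fin (N + 1 + 1) → ℝ => q i) p :=
    fun i => (ContinuousLinearMap.proj (R := ℝ) (φ := fun _ : Fin (N + 1 + 1) => ℝ) i).analyticAt p
  have hargA : AnalyticAt ℝ arg p := by
    rw [funext harg]
    exact analyticAt_pi_iff.2 fun j => (((analyticAt_const.fun_sub ((hc 1).fun_div (hc 0)
      h0)).fun_add (hc 1)).fun_mul (hc _)).fun_div (hc 0) h0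
  rw [funext hK₁]
  exact Finset.analyticAt_fun_sum _ fun k _ =>
    ((hc _).fun_div (hc 0) h0).fun_mul ((hD k (arg p) hp.2).fun_comp hargA)

/-! ### The stub -/

/-- **Stub S2 — local purity at `ϖ = 1`.** For one Nash cube function `h` of dimension `N`
(`ℚ`-semialgebraic and real-analytic on an open `W ⊇ [0,1]^N`) with `∫_{[0,1]^N} h = 0`, the
dilation function factors NEAR `ϖ = 1` through a twisted-diagonal Nash kernel: there are `ε > 0`,
`d₁`, an open `V₁ ⊇ (1−ε,1] × [0,1]^{d₁}` and `K₁` `ℚ`-semialgebraic and analytic on `V₁` with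
`∫ h(ϖz)dz = (ϖ − 1) ∫_{[0,1]^{d₁}} K₁(ϖ, ϖy) dy` for `ϖ ∈ (1−ε, 1]`. Witness: `d₁ = N + 1`,
`K₁(p) = Σₖ (p_{k+2}/p₀) ∂ₖh(arg p)`, `arg(p) = ((1 − p₁/p₀ + p₁) p_{k+2}/p₀)ₖ`,
`V₁ = {p₀ > 1/2} ∩ arg⁻¹(W)`, `ε = min(1/2, δ/(1+δ))` for a margin `[0,1+δ]^N ⊆ W`; the identity
is the fundamental theorem of calculus along `t ↦ (1 − t + ϖt) z` (`localPurity_ftc`), the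
hypothesis `∫ h = 0`, and Fubini `[0,1]^{N+1} = [0,1] × [0,1]^N` (`localPurity_integral_cube_succ`).
No arithmetic input; no kernel of this shape is claimed near `ϖ = 0`.
[cite: KontsevichZagier2001, §1.2] -/
theorem stub_localPurityAtOne :
    ∀ (N : ℕ) (h : (Fin N → ℝ) → ℝ) (W : Set (Fin N → ℝ)), IsOpen W → Set.pi Set.univ (fun _ : Fin N => Set.Icc (0:ℝ) 1) ⊆ W → Literature.NumberTheory.Transcendental.IsSemialgebraicFunOn ℚ W h → AnalyticOnNhd ℝ h W → (∫ z in Set.pi Set.univ (fun _ : Fin N => Set.Icc (0:ℝ) 1), h ((1:ℝ) • z)) = 0 → ∃ (ε : ℝ) (d₁ : ℕ) (K₁ : (Fin (d₁ + 1) → ℝ) → ℝ) (V₁ : Set (Fin (d₁ + 1) → ℝ)), 0 < ε ∧ IsOpen V₁ ∧ (∀ ϖ ∈ Set.Ioc (1 - ε) 1, ∀ x ∈ Set.pi Set.univ (fun _ : Fin d₁ => Set.Icc (0:ℝ) 1), Matrix.vecCons ϖ x ∈ V₁) ∧ Literature.NumberTheory.Transcendental.IsSemialgebraicFunOn ℚ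 V₁ K₁ ∧ AnalyticOnNhd ℝ K₁ V₁ ∧ ∀ ϖ ∈ Set.Ioc (1 - ε) 1, (∫ z in Set.pi Set.univ (fun _ : Fin N => Set.Icc (0:ℝ) 1), h (ϖ • z)) = (ϖ - 1) * ∫ y in Set.pi Set.univ (fun _ : Fin d₁ => Set.Icc (0:ℝ) 1), K₁ (Matrix.vecCons ϖ (ϖ • y)) := by
  intro N h W hWo hWc hWs hWa h1
  -- partial derivatives of `h`: analytic and semialgebraic on `W`
  have hDa : ∀ k : Fin N, AnalyticOnNhd ℝ (fun x => fderiv ℝ h x (Pi.single k 1)) W := fun k =>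
    localPurity_analyticOnNhd_fderiv_apply hWa _
  have hDs : ∀ k : Fin N, IsSemialgebraicFunOn ℚ W (fun x => fderiv ℝ h x (Pi.single k 1)) :=
    fun k => IsSemialgebraicFunOn.fderiv_apply_single hWo hWs
      (fun x hx => (hWa x hx).differentiableAt) k
  -- margin `[0, 1 + δ]^N ⊆ W`, and the kernel data `arg`, `K₁`, `V₁`
  obtain ⟨δ, hδ, hδW⟩ := localPurity_exists_margin hWo hWc
  obtain ⟨arg, harg⟩ : ∃ arg : (Fin (N + 1 + 1) → ℝ) → Fin N → ℝ,
      ∀ p, arg p = fun j => (1 - p 1 / p 0 + p 1) * p j.succ.succ / p 0 := ⟨_, fun p => rfl⟩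
  obtain ⟨K₁, hK₁⟩ : ∃ K₁ : (Fin (N + 1 + 1) → ℝ) → ℝ,
      ∀ p, K₁ p = ∑ k : Fin N, p k.succ.succ / p 0 * fderiv ℝ h (arg p) (Pi.single k 1) :=
    ⟨_, fun p => rfl⟩
  obtain ⟨V₁, hV₁⟩ : ∃ V₁ : Set (Fin (N + 1 + 1) → ℝ),
      V₁ = {p : Fin (N + 1 + 1) → ℝ | (1 / 2 : ℝ) < p 0} ∩ arg ⁻¹' W := ⟨_, rfl⟩
  obtain ⟨hargS, hV₁s⟩ :=
    localPurity_isSemialgebraic_V (IsSemialgebraicFunOn.isSemialgebraic_holds hWs) arg harg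
  have hK₁a : AnalyticOnNhd ℝ K₁ V₁ := hV₁ ▸
    localPurity_kernel_analyticOnNhd (fun k x => fderiv ℝ h x (Pi.single k 1)) hDa arg harg K₁ hK₁
  have hcont : ∀ ϖ ∈ Set.Ioc (1 - min (1 / 2 : ℝ) (δ / (1 + δ))) 1, ∀ x ∈ 𝐈^(N + 1),
      Matrix.vecCons ϖ x ∈ V₁ := fun ϖ hϖ x hx => hV₁ ▸ localPurity_cons_mem_V hδ hδW arg harg hϖ hx
  refine ⟨min (1 / 2) (δ / (1 + δ)), N + 1, K₁, V₁, lt_min one_half_pos (div_pos hδ (by linarith)),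
    hV₁ ▸ localPurity_isOpen_V hWo arg harg, hcont, hV₁ ▸ localPurity_kernel_isSemialgebraicFunOn
      (fun k x => fderiv ℝ h x (Pi.single k 1)) hDs arg hargS hV₁s K₁ hK₁, hK₁a, fun ϖ hϖ => ?_⟩
  -- the identity at `ϖ ∈ (1 - ε, 1]`
  have hϖhalf : (1 / 2 : ℝ) < ϖ := by linarith [hϖ.1, min_le_left (1 / 2 : ℝ) (δ / (1 + δ))]
  have hϖI : ϖ ∈ Set.Icc (0:ℝ) 1 := ⟨by linarith, hϖ.2⟩
  have hcpt : ∀ m : ℕ, IsCompact (𝐈^m) := fun m => isCompact_univ_pi fun _ => isCompact_Icc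
  -- (1) FTC along the segments, integrated over the cube, using `∫ h = 0`
  have hI1 : IntegrableOn (fun z => h (ϖ • z)) (𝐈^N) := by
    refine ContinuousOn.integrableOn_compact (hcpt N) fun z hz => ?_
    exact (ContinuousAt.comp' (f := fun z : Fin N → ℝ => ϖ • z) (x := z)
      (hWa _ (hWc (localPurity_smul_mem hϖI hz))).continuousAt
      (continuous_const_smul ϖ).continuousAt).continuousWithinAt
  have hI2 : IntegrableOn h (𝐈^N) := ContinuousOn.integrableOn_compact (hcpt N) fun z hz =>
    (hWa _ (hWc hz)).continuousAt.continuousWithinAt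
  have h1' : (∫ z in 𝐈^N, h z) = 0 := by simpa only [one_smul] using h1
  have hB : (∫ z in 𝐈^N, h (ϖ • z)) - (∫ z in 𝐈^N, h z) = (ϖ - 1) * ∫ z in 𝐈^N,
      ∫ t in (0:ℝ)..1, ∑ k, z k * fderiv ℝ h ((1 - t + ϖ * t) • z) (Pi.single k 1) := by
    rw [← integral_sub hI1 hI2, ← integral_const_mul]
    exact setIntegral_congr_fun (MeasurableSet.univ_pi fun _ => measurableSet_Icc)
      fun z hz => localPurity_ftc hWc hWa hϖI hz
  rw [h1', sub_zero] at hB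
  -- (2) Fubini: the kernel integral over `[0,1]^{N+1}` is the same iterated integral
  have hI3 : IntegrableOn (fun y => K₁ (Matrix.vecCons ϖ (ϖ • y))) (𝐈^(N + 1)) := by
    refine ContinuousOn.integrableOn_compact (hcpt (N + 1)) fun y hy => ?_
    have hγ : Continuous fun y : Fin (N + 1) → ℝ => Matrix.vecCons ϖ (ϖ • y) :=
      continuous_const.matrixVecCons (continuous_const_smul ϖ)
    exact (ContinuousAt.comp' (f := fun y : Fin (N + 1) → ℝ => Matrix.vecCons ϖ (ϖ • y)) (x := y)
      (hK₁a _ (hcont ϖ hϖ _ (localPurity_smul_mem hϖI hy))).continuousAt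
      hγ.continuousAt).continuousWithinAt
  have hC : (∫ y in 𝐈^(N + 1), K₁ (Matrix.vecCons ϖ (ϖ • y))) = ∫ z in 𝐈^N,
      ∫ t in (0:ℝ)..1, ∑ k, z k * fderiv ℝ h ((1 - t + ϖ * t) • z) (Pi.single k 1) := by
    rw [localPurity_integral_cube_succ N (fun y => K₁ (Matrix.vecCons ϖ (ϖ • y))) hI3]
    refine integral_congr_ae (Filter.Eventually.of_forall fun z => ?_)
    dsimp only
    rw [intervalIntegral.integral_of_le zero_le_one, ← integral_Icc_eq_integral_Ioc]
    exact setIntegral_congr_fun measurableSet_Icc fun t _ => localPurity_kernel_cons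
      (fun k x => fderiv ℝ h x (Pi.single k 1)) arg harg K₁ hK₁ (one_half_pos.trans hϖhalf).ne' t z
  rw [hB, hC]

end Summit.KontsevichZagierPeriods.LiftingCriteria.DilationLiftAtOne
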